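import Literature.MathematicalPhysics.QuantumLattice.TIStateMeanEntropy
import Literature.MathematicalPhysics.QuantumLattice.TranslationInvariantGroundStatesAreMeanEnergyMinimisers
import HarnessLib

/-!
# Box partition functions CAP the variational pressure, for every finite-range translation-invariant interaction:
# `n^d · P(β,Ψ) ≤ log Tr e^{−βH^Ψ_{[0,n)^d}} + β·(Ψ ∅)_{∅∅} + |β|·|collar_R([0,n)^d)|·S_Ψ`
# (the lower half of the Gibbs variational principle in the thermodynamic limit: `P ≤ liminf_n n^{-d} log Z_n`)

Topic `Literature/MathematicalPhysics/QuantumLattice` (family `hubbard`; crew hubbard-fast S2 «T > 0 / families of models»). With the mean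
entropy in hand (`TIStateMeanEntropy`: `s̄(ω) ≤ S(ω|_{[0,n)^d})/n^d` for EVERY `n`), the finite-volume Gibbs variational inequality
`S(ρ) − β Re tr(ρ H) ≤ log Tr e^{−βH}` (`GibbsVariationalPrinciple`) applied to the box marginal `ρ = ω|_{[0,n)^d}` of a translation-invariant
state, and the free-boundary energy bookkeeping `| |Λ|e_Ψ(ω) − (Re ω(H_Λ) − Re (Ψ∅)) | ≤ |collar|·S_Ψ`
(`TranslationInvariantGroundStatesAreMeanEnergyMinimisers`), give for EVERY Hermitian translation-invariant interaction `Ψ` of finite range `R`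
on `ℤ^d` (`d ≥ 1`), every real `β` and every `n ≥ 1`:

* `IsTranslationInvariant.sq_mul_sub_mul_le_log_partitionFn_add` — for every translation-invariant `ω`:
  `n^d (s̄(ω) − βe_Ψ(ω)) ≤ log Re Tr e^{−βH_{[0,n)^d}} + β (Ψ∅)_{∅∅} + |β| |thicken_R([0,n)^d) ∖ [0,n)^d| S_Ψ`;
* **`varPressure_le_log_partitionFn_box`** — the same with `P(β,Ψ)` on the left: ONE exactly computed (or certified from above) box partition
  function caps the thermodynamic-limit variational pressure of ANY such model (layered crystals, `t''`, decorated lattices, …), with an explicit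
  collar correction `|β| S_Ψ ((n + 2⌊R⌋)^d − n^d)` (`varPressure_le_log_partitionFn_box'`);
* `varPressure_le_of_limit` — if `n^{-d} log Re Tr e^{−βH_{[0,n)^d}} → p` then `P(β,Ψ) ≤ p` (the collar is `o(n^d)`).

Everything is PROVED; no definition, no named fact, no number. (The converse half `limsup n^{-d} log Z_n ≤ P` needs product states over box tilings
and is not in this file; for the `t–t'` Hubbard model both halves are `TIVariationalPressure` §4.)

## Mathlib / tree search

REUSED: `varPressure_le`, `entropyDensitySup` (`TIVariationalPressure`); `IsTranslationInvariant.entropyDensitySup_le_boxEntropyDensity`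
(`TIStateMeanEntropy`); `Matrix.IsHermitian.vonNeumannEntropy_sub_mul_le_log_partitionFn` (`GibbsVariationalPrinciple`); `localHamiltonian`,
`localHamiltonian_isHermitian`, `trace_rdm_mul`, `IsTranslationInvariant.abs_card_mul_meanEnergy_sub_le`, `expect_empty_eq`,
`card_thicken_halfOpenBox_sdiff_le`, `card_halfOpenBox`. `lean search 'varPressure_le_log_partitionFn|partitionFn.*varPressure'` (2026-08-28): nothing.

## References

* O. Bratteli, D. W. Robinson, *OAQSM 2* (1997), Thm. 6.2.40 and §6.2.4 (variational principle; `P ≥ s − βe` for every invariant state).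
  [cite: BratteliRobinsonII1997, Thm. 6.2.40]
* R. B. Israel, *Convexity in the Theory of Lattice Gases* (1979), Lemma II.3.1 (finite-volume variational principle). [cite: Israel1979, Lemma II.3.1]
* H. Araki, H. Moriya, Rev. Math. Phys. 15 (2003) 93, §11 eq. (11.21) (pressure and mean entropy). [cite: ArakiMoriya2003, Theorem 3.8 and §10]
* O. Bratteli, A. Kishimoto, D. W. Robinson, Commun. Math. Phys. 64 (1978) 41, §3 (surface energies are `o(|Λ|)`).
  [cite: BratteliKishimotoRobinson1978, Thm. 2 (proof, p. 48)]
-/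

noncomputable section

open scoped ComplexOrder BigOperators
open Finset Literature.InformationTheory.Entropy

namespace Literature.MathematicalPhysics.QuantumLattice

open Matrix HubbardWave0 Literature.Probability.LatticeModels ThermodynamicLimit
open _root_.Filter
open scoped _root_.Topology Matrix.Norms.L2Operator

namespace InfVolFermionState

variable {d : ℕ} {Ψ : FermionInteraction d} {R : ℝ}

/-- **Finite-volume Gibbs bound for a translation-invariant state**: for `Ψ` Hermitian, translation invariant, of finite range `R`, `d ≥ 1`,
`n ≥ 1`, every real `β` and every translation-invariant `ω`:
`n^d (s̄(ω) − βe_Ψ(ω)) ≤ log Re Tr e^{−βH_{[0,n)^d}} + β (Ψ∅)_{∅∅} + |β| |collar| S_Ψ`.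
[cite: Israel1979, Lemma II.3.1] [cite: BratteliRobinsonII1997, Thm. 6.2.40] -/
theorem IsTranslationInvariant.pow_mul_sub_mul_le_log_partitionFn_add (hd : 0 < d) (hH : Ψ.IsHermitian)
    (hT : Ψ.IsTranslationInvariant) (hR : Ψ.HasFiniteRange R) (β : ℝ) {ω : InfVolFermionState d} (hω : ω.IsTranslationInvariant)
    {n : ℕ} (hn : 1 ≤ n) :
    (n : ℝ) ^ d * (ω.entropyDensitySup - β * ω.meanEnergy Ψ R) ≤
      Real.log (Matrix.partitionFn β (Ψ.localHamiltonian (halfOpenBox d n))).re + β * ((Ψ.Φ ∅) ∅ ∅).re +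
        |β| * (((thicken (halfOpenBox d n) R \ halfOpenBox d n).card : ℝ) *
          ∑ X ∈ (thicken ({0} : Finset (Site d)) R).powerset with (0 : Site d) ∈ X, ‖Ψ.Φ X‖) := by
  set B := halfOpenBox d n with hB
  -- Gibbs variational inequality for the box marginal
  have hG := (FermionInteraction.localHamiltonian_isHermitian hH B).vonNeumannEntropy_sub_mul_le_log_partitionFn β
    (ω.rdm_posSemidef B) (ω.trace_rdm B)
  rw [trace_rdm_mul] at hG
  -- entropy: `n^d s̄ ≤ S(ω_B)`
  have hS := hω.entropyDensitySup_le_boxEntropyDensity hd hn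
  rw [boxEntropyDensity_apply, le_div_iff₀ (by positivity)] at hS
  -- energy: collar bookkeeping
  have hE := hω.abs_card_mul_meanEnergy_sub_le hT hR B
  rw [hB, card_halfOpenBox] at hE
  push_cast at hE
  rw [← hB] at hE
  rw [expect_empty_eq] at hE
  rw [abs_le] at hE
  set col : ℝ := ((thicken B R \ B).card : ℝ) * ∑ X ∈ (thicken ({0} : Finset (Site d)) R).powerset with (0 : Site d) ∈ X, ‖Ψ.Φ X‖
    with hcol
  have hcol0 : 0 ≤ col := by
    rw [hcol]; exact mul_nonneg (Nat.cast_nonneg _) (Finset.sum_nonneg fun _ _ => norm_nonneg _)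
  -- `β·n^d·e` against `β·(Re ω(H_B))`
  have hβE : -(β * ((n : ℝ) ^ d * ω.meanEnergy Ψ R)) ≤
      -(β * (ω.expect B (Ψ.localHamiltonian B)).re) + β * ((Ψ.Φ ∅) ∅ ∅).re + |β| * col := by
    rcases le_or_gt 0 β with hb | hb
    · rw [abs_of_nonneg hb]
      have h := mul_le_mul_of_nonneg_left hE.1 hb
      linarith
    · rw [abs_of_neg hb]
      have h := mul_le_mul_of_nonneg_left hE.2 (neg_nonneg.2 hb.le)
      linarith
  rw [← hB] at hS
  linarith [hG, hS, hβE]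

/-- **BOX PARTITION FUNCTIONS CAP THE VARIATIONAL PRESSURE**: for `Ψ` Hermitian, translation invariant, of finite range `R` on `ℤ^d`
(`d ≥ 1`), every real `β` and every `n ≥ 1`:
`n^d · P(β,Ψ) ≤ log Re Tr e^{−βH_{[0,n)^d}} + β (Ψ∅)_{∅∅} + |β| · |thicken_R([0,n)^d) ∖ [0,n)^d| · S_Ψ`.
[cite: BratteliRobinsonII1997, Thm. 6.2.40] [cite: Israel1979, Lemma II.3.1] -/
theorem varPressure_le_log_partitionFn_box (hd : 0 < d) (hH : Ψ.IsHermitian) (hT : Ψ.IsTranslationInvariant)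
    (hR : Ψ.HasFiniteRange R) (β : ℝ) {n : ℕ} (hn : 1 ≤ n) :
    (n : ℝ) ^ d * Ψ.varPressure β R ≤
      Real.log (Matrix.partitionFn β (Ψ.localHamiltonian (halfOpenBox d n))).re + β * ((Ψ.Φ ∅) ∅ ∅).re +
        |β| * (((thicken (halfOpenBox d n) R \ halfOpenBox d n).card : ℝ) *
          ∑ X ∈ (thicken ({0} : Finset (Site d)) R).powerset with (0 : Site d) ∈ X, ‖Ψ.Φ X‖) := by
  have hnd : (0 : ℝ) < (n : ℝ) ^ d := by positivity
  rw [← le_div_iff₀' hnd]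
  refine Ψ.varPressure_le β R fun ω hω => ?_
  rw [le_div_iff₀' hnd]
  exact hω.pow_mul_sub_mul_le_log_partitionFn_add hd hH hT hR β hn

/-- **Explicit collar**: the same with `|collar| ≤ (n + 2⌊R⌋)^d − n^d`. [cite: BratteliKishimotoRobinson1978, Thm. 2 (proof, p. 48)] -/
theorem varPressure_le_log_partitionFn_box' (hd : 0 < d) (hH : Ψ.IsHermitian) (hT : Ψ.IsTranslationInvariant)
    (hR : Ψ.HasFiniteRange R) (β : ℝ) {n : ℕ} (hn : 1 ≤ n) :
    (n : ℝ) ^ d * Ψ.varPressure β R ≤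
      Real.log (Matrix.partitionFn β (Ψ.localHamiltonian (halfOpenBox d n))).re + β * ((Ψ.Φ ∅) ∅ ∅).re +
        |β| * ((((n + 2 * ⌊R⌋₊) ^ d - n ^ d : ℕ) : ℝ) *
          ∑ X ∈ (thicken ({0} : Finset (Site d)) R).powerset with (0 : Site d) ∈ X, ‖Ψ.Φ X‖) := by
  refine (varPressure_le_log_partitionFn_box hd hH hT hR β hn).trans ?_
  have hS : 0 ≤ ∑ X ∈ (thicken ({0} : Finset (Site d)) R).powerset with (0 : Site d) ∈ X, ‖Ψ.Φ X‖ :=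
    Finset.sum_nonneg fun _ _ => norm_nonneg _
  have hc : ((thicken (halfOpenBox d n) R \ halfOpenBox d n).card : ℝ) ≤ (((n + 2 * ⌊R⌋₊) ^ d - n ^ d : ℕ) : ℝ) := by
    exact_mod_cast card_thicken_halfOpenBox_sdiff_le n R
  have := mul_le_mul_of_nonneg_left (mul_le_mul_of_nonneg_right hc hS) (abs_nonneg β)
  linarith

/-- **The lower half of the Gibbs variational principle in the thermodynamic limit**: if `n^{-d} log Re Tr e^{−βH_{[0,n)^d}} → p` then
`P(β,Ψ) ≤ p` (the collar term is `o(n^d)`). [cite: BratteliRobinsonII1997, Thm. 6.2.40] [cite: ArakiMoriya2003, Theorem 3.8 and §10] -/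
theorem varPressure_le_of_limit (hd : 0 < d) (hH : Ψ.IsHermitian) (hT : Ψ.IsTranslationInvariant) (hR : Ψ.HasFiniteRange R)
    (β : ℝ) {p : ℝ}
    (hlim : Tendsto (fun n : ℕ => Real.log (Matrix.partitionFn β (Ψ.localHamiltonian (halfOpenBox d n))).re / ((n : ℝ) ^ d))
      atTop (𝓝 p)) :
    Ψ.varPressure β R ≤ p := by
  -- the correction terms per volume tend to `0`
  set S : ℝ := ∑ X ∈ (thicken ({0} : Finset (Site d)) R).powerset with (0 : Site d) ∈ X, ‖Ψ.Φ X‖ with hSdef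
  set c : ℝ := β * ((Ψ.Φ ∅) ∅ ∅).re with hc
  set r : ℕ := 2 * ⌊R⌋₊ with hr
  -- `((n + r)^d − n^d)/n^d → 0` and `c/n^d → 0`
  have hpow : Tendsto (fun n : ℕ => ((n : ℝ) ^ d)) atTop atTop := by
    have h := (tendsto_natCast_atTop_atTop (R := ℝ)).comp (tendsto_pow_atTop (α := ℕ) (ne_of_gt hd))
    refine h.congr fun n => ?_
    simp
  have hc0 : Tendsto (fun n : ℕ => c / ((n : ℝ) ^ d)) atTop (𝓝 0) := tendsto_const_nhds.div_atTop hpow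
  have hratio : Tendsto (fun n : ℕ => (((n : ℝ) + r) ^ d - (n : ℝ) ^ d) / ((n : ℝ) ^ d)) atTop (𝓝 0) := by
    -- `((n+r)/n)^d − 1 → 0`
    have h1 : Tendsto (fun n : ℕ => ((n : ℝ) + r) / n) atTop (𝓝 1) := by
      have : Tendsto (fun n : ℕ => 1 + (r : ℝ) / n) atTop (𝓝 (1 + 0)) :=
        tendsto_const_nhds.add (tendsto_const_div_atTop_nhds_zero_nat _)
      rw [add_zero] at this
      refine this.congr' ?_
      filter_upwards [Filter.eventually_ge_atTop 1] with n hn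
      have hn0 : (n : ℝ) ≠ 0 := by exact_mod_cast (by omega : n ≠ 0)
      field_simp
    have h2 : Tendsto (fun n : ℕ => (((n : ℝ) + r) / n) ^ d - 1) atTop (𝓝 (1 ^ d - 1)) := (h1.pow d).sub tendsto_const_nhds
    rw [one_pow, sub_self] at h2
    refine h2.congr' ?_
    filter_upwards [Filter.eventually_ge_atTop 1] with n hn
    have hn0 : (n : ℝ) ^ d ≠ 0 := pow_ne_zero _ (by exact_mod_cast (by omega : n ≠ 0))
    rw [div_pow, sub_div, div_self hn0]
  have hcorr : Tendsto (fun n : ℕ => (c + |β| * ((((n : ℝ) + r) ^ d - (n : ℝ) ^ d) * S)) / ((n : ℝ) ^ d)) atTop (𝓝 0) := by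
    have h := hc0.add ((hratio.mul_const S).const_mul |β|)
    rw [zero_mul, mul_zero, add_zero] at h
    refine h.congr' ?_
    filter_upwards [Filter.eventually_ge_atTop 1] with n hn
    have hn0 : (n : ℝ) ^ d ≠ 0 := pow_ne_zero _ (by exact_mod_cast (by omega : n ≠ 0))
    field_simp
  have hsum := hlim.add hcorr
  rw [add_zero] at hsum
  refine ge_of_tendsto hsum ?_
  filter_upwards [Filter.eventually_ge_atTop 1] with n hn
  have hnd : (0 : ℝ) < (n : ℝ) ^ d := by positivity
  have hbox := varPressure_le_log_partitionFn_box' hd hH hT hR β hn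
  have hle : n ^ d ≤ (n + r) ^ d := Nat.pow_le_pow_left (Nat.le_add_right n r) d
  have hcast : (((n + 2 * ⌊R⌋₊) ^ d - n ^ d : ℕ) : ℝ) = ((n : ℝ) + r) ^ d - (n : ℝ) ^ d := by
    rw [← hr, Nat.cast_sub hle]
    push_cast
    ring
  rw [hcast, ← hSdef] at hbox
  rw [← add_div, le_div_iff₀ hnd]
  have e : Ψ.varPressure β R * (n : ℝ) ^ d = (n : ℝ) ^ d * Ψ.varPressure β R := mul_comm _ _
  rw [e]
  linarith

end InfVolFermionState

end Literature.MathematicalPhysics.QuantumLattice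

end
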